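import Literature.Geometry.Symplectic.TaubesFamilyBetaField
import Literature.Geometry.Symplectic.SymplecticFormalAdjoints
import Literature.Geometry.Symplectic.TaubesFamilyGradientBound
import Literature.Geometry.Symplectic.TaubesFamilyWeitzenbock
import Literature.Geometry.GaugeTheory.SeibergWittenAPrioriBoundPerturbed
import HarnessLib

/-!
# The Weitzenböck inequality for `β` along the family `(SW_r)`: Hutchings–Taubes (4.11)

Topic `Literature/Geometry/Symplectic`; the `K⁻¹`-component estimate of Taubes (1994) §3 (19)–(20) /
Hutchings–Taubes (1999) (4.11), for the tree's family: `(A, ψ)` a solution of the Seiberg–Witten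
equations of `𝔰_J` with perturbation `P₊F_{A₀} - (r/4)s`, `r = |c|²`, split as `ψ = αu₀ + β`
(`TaubesFamilyBetaField`).  The integrated Weitzenböck formula for the spinor field `β`
(`SymplecticFormalAdjoints.integral_weitzenbock_eq_zero`),

  `∫ (Σ_k|∇̃_kβ|² + (κ/4)|β|² + Re⟨β, ½iF_A·β⟩ - |D_Aβ|²)(s∧s) = 0`,

with the curvature equation inserted in the third term —
`Re⟨β, ½iF_A·β⟩ = ¼|β|²(|β|² - |α|²) + (r/4)|β|² + Re⟨β, ½iρ⁺(P₊F_{A₀})β⟩`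
(`re_curvature_pairing_betaField_eq`; `q(ψ)β = |β|²ψ - ½|ψ|²β`, `½iρ⁺(-(r/4)s) = (r/4)·diag(1,-1)`),
the last term bounded by `½‖P₊F_{A₀}‖|β|²` — gives, dropping `Σ_k|∇̃_kβ|² ≥ 0`,

  `∫ ((r/4 - K/4 - P/2)|β|² + ¼|β|⁴ - ¼|α|²|β|² - |D_Aβ|²)(s ∧ s) ≤ 0`

(`integral_betaField_weitzenbock_le`), `K = sup κ⁻`, `P = sup ‖P₊F_{A₀}‖`: Hutchings–Taubes's
"`∫|β|² ≤ (z/r)(∫|∂̄_a^*β|² + …)`" (4.11) in the tree's scaling, with `D_Aβ = -(∇'α)·u₀`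
(`dirac_betaField_eq_of_isSolution`).

PROVED, 0 named facts.

## References

* M. Hutchings, C. H. Taubes, *An introduction to the Seiberg–Witten equations on symplectic
  manifolds*, IAS/Park City Math. Ser. 7 (1999; AMS 2006), §4.4 (4.11). [HutchingsTaubes2006]
* C. H. Taubes, *The Seiberg–Witten invariants and symplectic forms*, Math. Res. Lett. 1 (1994)
  809–822, §3 (19)–(20). [Taubes1994]
-/

noncomputable section

open scoped Manifold ContDiff Topology ComplexConjugate Matrix
open Set Function Filter Complex Literature.Geometry.Kaehler Literature.Geometry.GaugeTheory Literature.Topology.FourManifolds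
open Literature.Geometry.Lorentzian (PseudoRiemannianMetric)
open Literature.Geometry.Manifold Literature.Geometry.Manifold.DeRhamSignFour Literature.NumberTheory.Transcendental

namespace Literature.Geometry.GaugeTheory

/-! ### Algebra: a positive spinor sees only `ρ⁺` -/

/-- **A positive spinor pairs with `ρ(ω)` through `ρ⁺(ω)`**: `⟨(b,0), c ρ(ω)(b,0)⟩ = ⟨b, c ρ⁺(ω) b⟩`.
[cite: MorganSWBook1996, Lemma 2.3.4] -/
theorem star_sumElim_dotProduct_smul_cliffordTwoForm_mulVec {Ω : Matrix (Fin 4) (Fin 4) ℝ} (hΩ : IsTwoForm Ω)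
    (b : Fin 2 → ℂ) (c : ℂ) :
    star (Sum.elim b (0 : Fin 2 → ℂ)) ⬝ᵥ (c • (cliffordTwoForm Ω *ᵥ Sum.elim b (0 : Fin 2 → ℂ))) =
      star b ⬝ᵥ (c • (plusAction Ω *ᵥ b)) := by
  have hsmul : ∀ p : Fin 2 → ℂ, c • Sum.elim p (0 : Fin 2 → ℂ) = Sum.elim (c • p) 0 := fun p ↦ by
    funext a
    rcases a with a | a <;> simp
  rw [cliffordTwoForm_eq_fromBlocks hΩ, Matrix.fromBlocks_mulVec, Sum.elim_comp_inl, Sum.elim_comp_inr, Function.star_sumElim, star_zero,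
    Matrix.mulVec_zero, Matrix.mulVec_zero, add_zero, Matrix.zero_mulVec, add_zero, hsmul, sumElim_dotProduct_sumElim,
    dotProduct_zero, add_zero]

/-- **`Re⟨b, ½q(ψ)b⟩ = ¼|β|²(|β|² - |α|²)`** for `ψ = (β, α)` (components `0`, `1`) and `b = (β, 0)`:
`q(ψ)b = |β|²ψ - ½|ψ|²b`. [cite: MorganSWBook1996, Lemma 4.2.1] -/
theorem re_star_dotProduct_half_spinorQuad_mulVec (ψ : Fin 2 → ℂ) :
    (star ![ψ 0, 0] ⬝ᵥ ((2 : ℂ)⁻¹ • (spinorQuad ψ *ᵥ ![ψ 0, 0]))).re =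
      Complex.normSq (ψ 0) * (Complex.normSq (ψ 0) - Complex.normSq (ψ 1)) / 4 := by
  rw [spinorQuad_eq]
  simp only [Matrix.mulVec, dotProduct, Fin.sum_univ_two, Pi.star_apply, Pi.smul_apply, Matrix.of_apply,
    Matrix.cons_val', Matrix.cons_val_zero, Matrix.cons_val_one, Matrix.cons_val_fin_one, Matrix.empty_val',
    smul_eq_mul, Complex.star_def, mul_zero, add_zero, map_zero, zero_mul]
  have h0 : conj (ψ 0) * ψ 0 = (Complex.normSq (ψ 0) : ℂ) := (Complex.normSq_eq_conj_mul_self).symm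
  have key : conj (ψ 0) * (2⁻¹ * (((Complex.normSq (ψ 0) - Complex.normSq (ψ 1)) / 2 : ℝ) * ψ 0)) =
      ((Complex.normSq (ψ 0) * (Complex.normSq (ψ 0) - Complex.normSq (ψ 1)) / 4 : ℝ) : ℂ) := by
    push_cast
    linear_combination ((Complex.normSq (ψ 0) - Complex.normSq (ψ 1) : ℂ) / 4) * h0
  rw [show ((((Complex.normSq (ψ 0) - Complex.normSq (ψ 1)) / 2 : ℝ) : ℂ)) =
    ((Complex.normSq (ψ 0) : ℂ) - (Complex.normSq (ψ 1) : ℂ)) / 2 by push_cast; ring] at key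
  rw [key, Complex.ofReal_re]

end Literature.Geometry.GaugeTheory

namespace Literature.Geometry.Symplectic

open Literature.Geometry.GaugeTheory.SpincStructure

namespace AlmostComplexStructure.IsCompatibleWith

variable {N : Type} [TopologicalSpace N] [ChartedSpace (EuclideanSpace ℝ (Fin 4)) N] [IsManifold (𝓡 4) ∞ N]
  {J : AlmostComplexStructure (𝓡 4) ∞ N} {s : MForm (𝓡 4) N ℝ 2}
  (h : J.IsCompatibleWith s) (hs : IsSmoothForm s)
  (hnd : ∀ x (v : TangentSpace (𝓡 4) x), v ≠ 0 → ∃ w : TangentSpace (𝓡 4) x, s x ![v, w] ≠ 0)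

/-! ### The curvature term of the Weitzenböck formula on `β` -/

/-- `β_i(x) = ((ψ₀, 0), 0)` on the chart. [folklore] -/
theorem betaField_toFun_eq_sumElim (cfg : (h.canonicalSpincStructure hs hnd).Configuration) (i : N) {x : N}
    (hx : x ∈ (h.canonicalSpincStructure hs hnd).baseSet i) :
    (h.betaField hs hnd cfg).toFun i x = Sum.elim ![cfg.plusSpinor i x 0, 0] 0 := by
  funext a
  rcases a with a | b
  · fin_cases a
    · simp [SpincStructure.Configuration.plusSpinor]
    · simpa using h.betaField_toFun_inl_one hs hnd cfg i hx
  · simpa using h.betaField_toFun_inr hs hnd cfg i hx b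

/-- **The curvature term on `β` for a solution of the family**:
`Re⟨β, ½iF_A·β⟩ = ¼|β|²(|β|² - |α|²) + (r/4)|β|² + Re⟨b, ½iρ⁺(P₊F_{A₀})b⟩`, `b = (β, 0) ∈ S⁺`
(curvature equation `iρ⁺(F_A) = q(ψ) + iρ⁺(P₊F_{A₀} - (r/4)s)`, `Re⟨b, ½q(ψ)b⟩ = ¼|β|²(|β|²-|α|²)`,
`Re⟨b, ½iρ⁺(-(r/4)s)b⟩ = (r/4)|β|²`). [cite: HutchingsTaubes2006, §4.4 (4.11)] [cite: Taubes1994, §3 (17)] -/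
theorem re_curvature_pairing_betaField_eq [(h.metric hs).HasLeviCivita] (c : ℂ)
    {cfg : (h.canonicalSpincStructure hs hnd).Configuration}
    (hsol : SpincStructure.IsSolution (h.taubesPerturbation hs hnd - h.symplecticPerturbation hs hnd (Complex.normSq c / 4)) cfg)
    (i : N) {x : N} (hx : x ∈ (h.canonicalSpincStructure hs hnd).baseSet i) :
    (star ((h.betaField hs hnd cfg).toFun i x) ⬝ᵥ (((2 : ℂ)⁻¹ * I) •
        (cliffordTwoForm ((h.canonicalSpincStructure hs hnd).extDerivMatrix (cfg.conn.form i) i x) *ᵥ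
          (h.betaField hs hnd cfg).toFun i x))).re =
      Complex.normSq (cfg.plusSpinor i x 0) * (Complex.normSq (cfg.plusSpinor i x 0) - Complex.normSq (cfg.plusSpinor i x 1)) / 4 +
        Complex.normSq c / 4 * Complex.normSq (cfg.plusSpinor i x 0) +
        (star ![cfg.plusSpinor i x 0, 0] ⬝ᵥ (((2 : ℂ)⁻¹ * I) •
          (plusAction (twoFormMatrix (h.taubesPerturbation hs hnd).form x fun k ↦ (h.canonicalSpincStructure hs hnd).frame i k x) *ᵥ
            ![cfg.plusSpinor i x 0, 0]))).re := by
  have hcurv := (hsol i x hx).1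
  rw [← curvatureMatrix_eq_extDerivMatrix, h.betaField_toFun_eq_sumElim hs hnd cfg i hx,
    star_sumElim_dotProduct_smul_cliffordTwoForm_mulVec ((h.canonicalSpincStructure hs hnd).isTwoForm_curvatureMatrix _ _ _)]
  -- insert the curvature equation: `(½i)ρ⁺(F_A)b = ½q(ψ)b + (½i)ρ⁺(η)b`
  have hsplit : ((2 : ℂ)⁻¹ * I) • (plusAction ((h.canonicalSpincStructure hs hnd).curvatureMatrix cfg.conn i x) *ᵥ ![cfg.plusSpinor i x 0, 0]) =
      (2 : ℂ)⁻¹ • (spinorQuad (cfg.plusSpinor i x) *ᵥ ![cfg.plusSpinor i x 0, 0]) +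
        (((2 : ℂ)⁻¹ * I) • (plusAction (twoFormMatrix (h.taubesPerturbation hs hnd).form x fun k ↦ (h.canonicalSpincStructure hs hnd).frame i k x) *ᵥ
            ![cfg.plusSpinor i x 0, 0]) -
          ((2 : ℂ)⁻¹ * I) • (plusAction (twoFormMatrix ((Complex.normSq c / 4) • s) x fun k ↦ (h.canonicalSpincStructure hs hnd).frame i k x) *ᵥ
            ![cfg.plusSpinor i x 0, 0])) := by
    have h1 : ((2 : ℂ)⁻¹ * I) • (plusAction ((h.canonicalSpincStructure hs hnd).curvatureMatrix cfg.conn i x) *ᵥ ![cfg.plusSpinor i x 0, 0]) =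
        (2 : ℂ)⁻¹ • ((I • plusAction ((h.canonicalSpincStructure hs hnd).curvatureMatrix cfg.conn i x)) *ᵥ ![cfg.plusSpinor i x 0, 0]) := by
      rw [Matrix.smul_mulVec, smul_smul]
    rw [h1, hcurv, SpincStructure.Perturbation.plusAction_twoFormMatrix_sub, symplecticPerturbation_form, smul_sub, Matrix.add_mulVec,
      Matrix.sub_mulVec, smul_add, smul_sub, Matrix.smul_mulVec, Matrix.smul_mulVec, smul_smul, smul_smul]
  rw [hsplit, dotProduct_add, dotProduct_sub, Complex.add_re, Complex.sub_re, re_star_dotProduct_half_spinorQuad_mulVec,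
    h.re_star_dotProduct_half_I_plusAction_symplectic hs hnd (Complex.normSq c / 4) i hx]
  simp only [Matrix.cons_val_one, Matrix.cons_val_zero, map_zero]
  ring

/-- **`|Re⟨b, ½iρ⁺(P₊F_{A₀})b⟩| ≤ ½‖P₊F_{A₀}‖ |β|²`** (Cauchy–Schwarz, `|ρ⁺(θ)b| = |θ⁺||b|`).
[cite: MorganSWBook1996, Prop. 6.4.1 (proof)] -/
theorem abs_re_perturbation_pairing_beta_le [(h.metric hs).HasLeviCivita] (cfg : (h.canonicalSpincStructure hs hnd).Configuration)
    (i : N) (x : N) :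
    |(star ![cfg.plusSpinor i x 0, 0] ⬝ᵥ (((2 : ℂ)⁻¹ * I) •
        (plusAction (twoFormMatrix (h.taubesPerturbation hs hnd).form x fun k ↦ (h.canonicalSpincStructure hs hnd).frame i k x) *ᵥ
          ![cfg.plusSpinor i x 0, 0]))).re| ≤
      2⁻¹ * (h.canonicalSpincStructure hs hnd).perturbationNorm (h.taubesPerturbation hs hnd) i x * Complex.normSq (cfg.plusSpinor i x 0) := by
  have hb := abs_re_star_dotProduct_half_I_plusAction_le
    (twoFormMatrix (h.taubesPerturbation hs hnd).form x fun k ↦ (h.canonicalSpincStructure hs hnd).frame i k x) ![cfg.plusSpinor i x 0, 0]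
  have hn : spinorNormSq ![cfg.plusSpinor i x 0, 0] = Complex.normSq (cfg.plusSpinor i x 0) := by
    simp [spinorNormSq]
  rw [hn] at hb
  exact hb


/-! ### The Weitzenböck integrand is smooth -/

/-- **The Weitzenböck integrand `Σ_k|∇̃_kψ|² + Re⟨ψ, (κ/4)ψ + ½iF_A·ψ⟩ - |D_Aψ|²` of a smooth spinor
field is smooth**: it is the sum of the divergences of `Re⟨ψ, γ(·)D_Aψ⟩` and `Re⟨ψ, ∇̃ψ⟩`
(`SymplecticFormalAdjoints`). [cite: MorganSWBook1996, Cor. 5.2.2 (proof)] -/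
theorem contMDiff_weitzenbockIntegrand [(h.metric hs).HasLeviCivita] (A : (h.canonicalSpincStructure hs hnd).detLineBundle.Connection)
    {ψ : SpinorField (h.canonicalSpincStructure hs hnd)} (hψ : ψ.IsSmooth) :
    ContMDiff (𝓡 4) 𝓘(ℝ, ℝ) ∞ (fun x ↦
      (∑ k, (star (SpincStructure.covDeriv A ψ ((h.canonicalSpincStructure hs hnd).indexAt x) x ((h.canonicalSpincStructure hs hnd).frame ((h.canonicalSpincStructure hs hnd).indexAt x) k x)) ⬝ᵥ
          SpincStructure.covDeriv A ψ ((h.canonicalSpincStructure hs hnd).indexAt x) x ((h.canonicalSpincStructure hs hnd).frame ((h.canonicalSpincStructure hs hnd).indexAt x) k x)).re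
        + (star (ψ.toFun ((h.canonicalSpincStructure hs hnd).indexAt x) x) ⬝ᵥ
            (((4 : ℂ)⁻¹ * (((h.canonicalSpincStructure hs hnd).frameScalarCurv ((h.canonicalSpincStructure hs hnd).indexAt x) x : ℝ) : ℂ)) • ψ.toFun ((h.canonicalSpincStructure hs hnd).indexAt x) x
              + ((2 : ℂ)⁻¹ * I) • (cliffordTwoForm ((h.canonicalSpincStructure hs hnd).extDerivMatrix (A.form ((h.canonicalSpincStructure hs hnd).indexAt x)) ((h.canonicalSpincStructure hs hnd).indexAt x) x) *ᵥ ψ.toFun ((h.canonicalSpincStructure hs hnd).indexAt x) x))).re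
        - (star (SpincStructure.dirac A ψ ((h.canonicalSpincStructure hs hnd).indexAt x) x) ⬝ᵥ SpincStructure.dirac A ψ ((h.canonicalSpincStructure hs hnd).indexAt x) x).re)) := by
  have hDψ := (h.canonicalSpincStructure hs hnd).isSmooth_diracField A hψ
  have hθ₁ : IsSmoothForm ((h.canonicalSpincStructure hs hnd).cliffordPairingForm ((h.canonicalSpincStructure hs hnd).diracField A hψ) ψ).toMForm :=
    fun x ↦ (h.canonicalSpincStructure hs hnd).smoothAt_cliffordPairingForm hDψ hψ x
  have hθ₂ : IsSmoothForm ((h.canonicalSpincStructure hs hnd).covDerivPairingForm A ψ ψ).toMForm :=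
    fun x ↦ (h.canonicalSpincStructure hs hnd).smoothAt_covDerivPairingForm A hψ hψ x
  have hs₁ := h.contMDiff_divergence hs hnd hθ₁
  have hs₂ := h.contMDiff_divergence hs hnd hθ₂
  refine (hs₁.add hs₂).congr fun x ↦ ?_
  have hi := (h.canonicalSpincStructure hs hnd).mem_baseSet_indexAt x
  have hW := (h.canonicalSpincStructure hs hnd).localDirac_dirac A hψ hi
  have hdd : SpincStructure.dirac A ((h.canonicalSpincStructure hs hnd).diracField A hψ) ((h.canonicalSpincStructure hs hnd).indexAt x) x =
      (h.canonicalSpincStructure hs hnd).localDirac A ((h.canonicalSpincStructure hs hnd).indexAt x) (fun y ↦ SpincStructure.dirac A ψ ((h.canonicalSpincStructure hs hnd).indexAt x) y) x := by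
    rw [(h.canonicalSpincStructure hs hnd).dirac_eq_localDirac]
    rfl
  rw [h.divergence_cliffordPairingForm_eq hs hnd A hDψ hψ, h.divergence_covDerivPairingForm_eq hs hnd A hψ hψ]
  simp only [Pi.add_apply]
  rw [SpincStructure.diracField_toFun, hdd, hW]
  simp only [dotProduct_add, Complex.add_re]
  ring

/-! ### The integrated Weitzenböck formula on `β` -/

/-- **The Weitzenböck integrand of `β`, curvature equation inserted** (pointwise, chart at the point):
`Σ_k|∇̃_kβ|² + Re⟨β,(κ/4)β + ½iF_A·β⟩ - |D_Aβ|²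
 = Σ_k|∇̃_kβ|² + (κ/4)|β|² + ¼|β|²(|β|²-|α|²) + (r/4)|β|² + Re⟨b, ½iρ⁺(P₊F_{A₀})b⟩ - |D_Aβ|²`.
[cite: HutchingsTaubes2006, §4.4 (4.11)] [cite: Taubes1994, §3 (17)] -/
theorem betaField_weitzenbockIntegrand_eq [(h.metric hs).HasLeviCivita] (c : ℂ) {cfg : (h.canonicalSpincStructure hs hnd).Configuration}
    (hsol : SpincStructure.IsSolution (h.taubesPerturbation hs hnd - h.symplecticPerturbation hs hnd (Complex.normSq c / 4)) cfg)
    (x : N) :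
    (∑ k, (star (SpincStructure.covDeriv cfg.conn (h.betaField hs hnd cfg) ((h.canonicalSpincStructure hs hnd).indexAt x) x ((h.canonicalSpincStructure hs hnd).frame ((h.canonicalSpincStructure hs hnd).indexAt x) k x)) ⬝ᵥ
          SpincStructure.covDeriv cfg.conn (h.betaField hs hnd cfg) ((h.canonicalSpincStructure hs hnd).indexAt x) x ((h.canonicalSpincStructure hs hnd).frame ((h.canonicalSpincStructure hs hnd).indexAt x) k x)).re
        + (star ((h.betaField hs hnd cfg).toFun ((h.canonicalSpincStructure hs hnd).indexAt x) x) ⬝ᵥ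
            (((4 : ℂ)⁻¹ * (((h.canonicalSpincStructure hs hnd).frameScalarCurv ((h.canonicalSpincStructure hs hnd).indexAt x) x : ℝ) : ℂ)) • (h.betaField hs hnd cfg).toFun ((h.canonicalSpincStructure hs hnd).indexAt x) x
              + ((2 : ℂ)⁻¹ * I) • (cliffordTwoForm ((h.canonicalSpincStructure hs hnd).extDerivMatrix (cfg.conn.form ((h.canonicalSpincStructure hs hnd).indexAt x)) ((h.canonicalSpincStructure hs hnd).indexAt x) x) *ᵥ (h.betaField hs hnd cfg).toFun ((h.canonicalSpincStructure hs hnd).indexAt x) x))).re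
        - (star (SpincStructure.dirac cfg.conn (h.betaField hs hnd cfg) ((h.canonicalSpincStructure hs hnd).indexAt x) x) ⬝ᵥ SpincStructure.dirac cfg.conn (h.betaField hs hnd cfg) ((h.canonicalSpincStructure hs hnd).indexAt x) x).re) =
      ((∑ k, (star (SpincStructure.covDeriv cfg.conn (h.betaField hs hnd cfg) ((h.canonicalSpincStructure hs hnd).indexAt x) x ((h.canonicalSpincStructure hs hnd).frame ((h.canonicalSpincStructure hs hnd).indexAt x) k x)) ⬝ᵥ
            SpincStructure.covDeriv cfg.conn (h.betaField hs hnd cfg) ((h.canonicalSpincStructure hs hnd).indexAt x) x ((h.canonicalSpincStructure hs hnd).frame ((h.canonicalSpincStructure hs hnd).indexAt x) k x)).re)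
          + (h.metric hs).scalarCurvature x / 4 * h.betaSq hs hnd cfg x
          + h.betaSq hs hnd cfg x * (h.betaSq hs hnd cfg x - h.alphaSq hs hnd cfg x) / 4
          + Complex.normSq c / 4 * h.betaSq hs hnd cfg x
          + (star ![cfg.plusSpinor ((h.canonicalSpincStructure hs hnd).indexAt x) x 0, 0] ⬝ᵥ (((2 : ℂ)⁻¹ * I) •
              (plusAction (twoFormMatrix (h.taubesPerturbation hs hnd).form x fun k ↦ (h.canonicalSpincStructure hs hnd).frame ((h.canonicalSpincStructure hs hnd).indexAt x) k x) *ᵥ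
                ![cfg.plusSpinor ((h.canonicalSpincStructure hs hnd).indexAt x) x 0, 0]))).re
          - ((h.canonicalSpincStructure hs hnd).diracField cfg.conn (h.isSmooth_betaField hs hnd cfg)).hermNormSq x) := by
  have hi := (h.canonicalSpincStructure hs hnd).mem_baseSet_indexAt x
  rw [dotProduct_add, Complex.add_re, h.re_curvature_pairing_betaField_eq hs hnd c hsol _ hi]
  simp only [dotProduct_smul, smul_eq_mul]
  rw [h.star_dotProduct_betaField_self hs hnd cfg _ hi, (h.canonicalSpincStructure hs hnd).frameScalarCurv_eq_scalarCurvature _ hi,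
    SpinorField.hermNormSq, SpincStructure.diracField_toFun, star_dotProduct_self_eq_spinorHermNormSq, Complex.ofReal_re]
  have hre : ((4 : ℂ)⁻¹ * (((h.metric hs).scalarCurvature x : ℝ) : ℂ) * ((Complex.normSq (cfg.plusSpinor ((h.canonicalSpincStructure hs hnd).indexAt x) x 0) : ℝ) : ℂ)).re =
      (h.metric hs).scalarCurvature x / 4 * Complex.normSq (cfg.plusSpinor ((h.canonicalSpincStructure hs hnd).indexAt x) x 0) := by
    rw [show (4 : ℂ)⁻¹ * (((h.metric hs).scalarCurvature x : ℝ) : ℂ) * ((Complex.normSq (cfg.plusSpinor ((h.canonicalSpincStructure hs hnd).indexAt x) x 0) : ℝ) : ℂ) =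
      (((h.metric hs).scalarCurvature x / 4 * Complex.normSq (cfg.plusSpinor ((h.canonicalSpincStructure hs hnd).indexAt x) x 0) : ℝ) : ℂ) by push_cast; ring, Complex.ofReal_re]
  rw [hre]
  unfold alphaSq betaSq
  ring

/-- The inserted integrand is smooth. [folklore] -/
theorem contMDiff_betaField_weitzenbockIntegrand [(h.metric hs).HasLeviCivita] (c : ℂ) {cfg : (h.canonicalSpincStructure hs hnd).Configuration}
    (hsol : SpincStructure.IsSolution (h.taubesPerturbation hs hnd - h.symplecticPerturbation hs hnd (Complex.normSq c / 4)) cfg) :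
    ContMDiff (𝓡 4) 𝓘(ℝ, ℝ) ∞ (fun x ↦
      ((∑ k, (star (SpincStructure.covDeriv cfg.conn (h.betaField hs hnd cfg) ((h.canonicalSpincStructure hs hnd).indexAt x) x ((h.canonicalSpincStructure hs hnd).frame ((h.canonicalSpincStructure hs hnd).indexAt x) k x)) ⬝ᵥ
            SpincStructure.covDeriv cfg.conn (h.betaField hs hnd cfg) ((h.canonicalSpincStructure hs hnd).indexAt x) x ((h.canonicalSpincStructure hs hnd).frame ((h.canonicalSpincStructure hs hnd).indexAt x) k x)).re)
          + (h.metric hs).scalarCurvature x / 4 * h.betaSq hs hnd cfg x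
          + h.betaSq hs hnd cfg x * (h.betaSq hs hnd cfg x - h.alphaSq hs hnd cfg x) / 4
          + Complex.normSq c / 4 * h.betaSq hs hnd cfg x
          + (star ![cfg.plusSpinor ((h.canonicalSpincStructure hs hnd).indexAt x) x 0, 0] ⬝ᵥ (((2 : ℂ)⁻¹ * I) •
              (plusAction (twoFormMatrix (h.taubesPerturbation hs hnd).form x fun k ↦ (h.canonicalSpincStructure hs hnd).frame ((h.canonicalSpincStructure hs hnd).indexAt x) k x) *ᵥ
                ![cfg.plusSpinor ((h.canonicalSpincStructure hs hnd).indexAt x) x 0, 0]))).re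
          - ((h.canonicalSpincStructure hs hnd).diracField cfg.conn (h.isSmooth_betaField hs hnd cfg)).hermNormSq x)) :=
  (h.contMDiff_weitzenbockIntegrand hs hnd cfg.conn (h.isSmooth_betaField hs hnd cfg)).congr fun x ↦
    (h.betaField_weitzenbockIntegrand_eq hs hnd c hsol x).symm

/-- **The Weitzenböck identity on `β` for a solution of the family** (curvature term inserted):
`∫ (Σ_k|∇̃_kβ|² + (κ/4)|β|² + ¼|β|²(|β|²-|α|²) + (r/4)|β|² + Re⟨b, ½iρ⁺(P₊F_{A₀})b⟩ - |D_Aβ|²)(s∧s) = 0`.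
[cite: HutchingsTaubes2006, §4.4 (4.11)] [cite: Taubes1994, §3 (17)–(19)] -/
theorem integral_betaField_weitzenbock_eq_zero [T2Space N] [CompactSpace N] [(h.metric hs).HasLeviCivita]
    (hcl : IsClosedForm s) (c : ℂ) {cfg : (h.canonicalSpincStructure hs hnd).Configuration}
    (hsol : SpincStructure.IsSolution (h.taubesPerturbation hs hnd - h.symplecticPerturbation hs hnd (Complex.normSq c / 4)) cfg) :
    MForm.integral (rayFamily (wedge_self_castDeg_apply_ne_zero s hnd))
      ((fun x ↦
        ((∑ k, (star (SpincStructure.covDeriv cfg.conn (h.betaField hs hnd cfg) ((h.canonicalSpincStructure hs hnd).indexAt x) x ((h.canonicalSpincStructure hs hnd).frame ((h.canonicalSpincStructure hs hnd).indexAt x) k x)) ⬝ᵥ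
            SpincStructure.covDeriv cfg.conn (h.betaField hs hnd cfg) ((h.canonicalSpincStructure hs hnd).indexAt x) x ((h.canonicalSpincStructure hs hnd).frame ((h.canonicalSpincStructure hs hnd).indexAt x) k x)).re)
          + (h.metric hs).scalarCurvature x / 4 * h.betaSq hs hnd cfg x
          + h.betaSq hs hnd cfg x * (h.betaSq hs hnd cfg x - h.alphaSq hs hnd cfg x) / 4
          + Complex.normSq c / 4 * h.betaSq hs hnd cfg x
          + (star ![cfg.plusSpinor ((h.canonicalSpincStructure hs hnd).indexAt x) x 0, 0] ⬝ᵥ (((2 : ℂ)⁻¹ * I) •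
              (plusAction (twoFormMatrix (h.taubesPerturbation hs hnd).form x fun k ↦ (h.canonicalSpincStructure hs hnd).frame ((h.canonicalSpincStructure hs hnd).indexAt x) k x) *ᵥ
                ![cfg.plusSpinor ((h.canonicalSpincStructure hs hnd).indexAt x) x 0, 0]))).re
          - ((h.canonicalSpincStructure hs hnd).diracField cfg.conn (h.isSmooth_betaField hs hnd cfg)).hermNormSq x)) •
        (s.wedge s).castDeg two_add_two_eq_four) = 0 := by
  have hI := h.integral_weitzenbock_eq_zero hs hnd hcl cfg.conn (h.isSmooth_betaField hs hnd cfg)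
  simp only [h.betaField_weitzenbockIntegrand_eq hs hnd c hsol] at hI
  exact hI

/-- **Hutchings–Taubes (4.11) for the family**: for a solution `(A, ψ = αu₀ + β)` of `(SW)` with
perturbation `P₊F_{A₀} - (r/4)s`,
`∫ ((r/4 - K/4 - P/2)|β|² + ¼|β|⁴ - ¼|α|²|β|² - |D_Aβ|²)(s ∧ s) ≤ 0`,
`K = sup_N κ⁻`, `P = sup_N ‖P₊F_{A₀}‖` (drop `Σ_k|∇̃_kβ|² ≥ 0` in the Weitzenböck identity on `β` and
bound the curvature and perturbation terms pointwise); here `|D_Aβ|² = |(∇'α)·u₀|²` by the Dirac equation.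
[cite: HutchingsTaubes2006, §4.4 (4.11)] [cite: Taubes1994, §3 (19)–(20)] -/
theorem integral_betaField_weitzenbock_le [T2Space N] [CompactSpace N] [(h.metric hs).HasLeviCivita]
    (hcl : IsClosedForm s) (c : ℂ) {cfg : (h.canonicalSpincStructure hs hnd).Configuration}
    (hsol : SpincStructure.IsSolution (h.taubesPerturbation hs hnd - h.symplecticPerturbation hs hnd (Complex.normSq c / 4)) cfg) :
    MForm.integral (rayFamily (wedge_self_castDeg_apply_ne_zero s hnd))
      ((fun x ↦
        (Complex.normSq c / 4 - (⨆ y, max (-(h.metric hs).scalarCurvature y) 0) / 4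
            - (⨆ y, (h.canonicalSpincStructure hs hnd).perturbationNorm (h.taubesPerturbation hs hnd) ((h.canonicalSpincStructure hs hnd).indexAt y) y) / 2) * h.betaSq hs hnd cfg x
          + 4⁻¹ * h.betaSq hs hnd cfg x ^ 2 - 4⁻¹ * h.alphaSq hs hnd cfg x * h.betaSq hs hnd cfg x
          - ((h.canonicalSpincStructure hs hnd).diracField cfg.conn (h.isSmooth_betaField hs hnd cfg)).hermNormSq x) •
        (s.wedge s).castDeg two_add_two_eq_four) ≤ 0 := by
  have hv : IsSmoothForm ((s.wedge s).castDeg two_add_two_eq_four) := (wedge_self_castDeg_mem_closedSmoothForms ⟨hs, hcl⟩).1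
  have hne := wedge_self_castDeg_apply_ne_zero s hnd
  have hG := h.contMDiff_betaField_weitzenbockIntegrand hs hnd c hsol
  have hG0 := h.integral_betaField_weitzenbock_eq_zero hs hnd hcl c hsol
  -- smoothness of the lower bound
  have hB := h.contMDiff_betaSq hs hnd cfg
  have hA := h.contMDiff_alphaSq hs hnd cfg
  have hH := (h.canonicalSpincStructure hs hnd).contMDiff_hermNormSq
    ((h.canonicalSpincStructure hs hnd).isSmooth_diracField cfg.conn (h.isSmooth_betaField hs hnd cfg))
  obtain ⟨C, hC⟩ : ∃ C : ℝ, C = Complex.normSq c / 4 - (⨆ y, max (-(h.metric hs).scalarCurvature y) 0) / 4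
      - (⨆ y, (h.canonicalSpincStructure hs hnd).perturbationNorm (h.taubesPerturbation hs hnd) ((h.canonicalSpincStructure hs hnd).indexAt y) y) / 2 := ⟨_, rfl⟩
  have hp : ContDiff ℝ ∞ (fun q : ℝ × ℝ × ℝ ↦ C * q.1 + 4⁻¹ * q.1 ^ 2 - 4⁻¹ * q.2.1 * q.1 - q.2.2) := by fun_prop
  have hL : ContMDiff (𝓡 4) 𝓘(ℝ, ℝ) ∞ (fun x ↦ C * h.betaSq hs hnd cfg x
      + 4⁻¹ * h.betaSq hs hnd cfg x ^ 2 - 4⁻¹ * h.alphaSq hs hnd cfg x * h.betaSq hs hnd cfg x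
      - ((h.canonicalSpincStructure hs hnd).diracField cfg.conn (h.isSmooth_betaField hs hnd cfg)).hermNormSq x) :=
    hp.comp_contMDiff (hB.prodMk_space (hA.prodMk_space hH))
  rw [← hC]
  refine (integral_fun_smul_mono hv hne hL hG fun x ↦ ?_).trans_eq hG0
  -- the pointwise comparison
  have hS : 0 ≤ ∑ k, (star (SpincStructure.covDeriv cfg.conn (h.betaField hs hnd cfg) ((h.canonicalSpincStructure hs hnd).indexAt x) x ((h.canonicalSpincStructure hs hnd).frame ((h.canonicalSpincStructure hs hnd).indexAt x) k x)) ⬝ᵥ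
      SpincStructure.covDeriv cfg.conn (h.betaField hs hnd cfg) ((h.canonicalSpincStructure hs hnd).indexAt x) x ((h.canonicalSpincStructure hs hnd).frame ((h.canonicalSpincStructure hs hnd).indexAt x) k x)).re :=
    Finset.sum_nonneg fun k _ ↦ re_star_dotProduct_self_nonneg _
  have hb0 := h.betaSq_nonneg hs hnd cfg x
  have hK : -(h.metric hs).scalarCurvature x ≤ ⨆ y, max (-(h.metric hs).scalarCurvature y) 0 :=
    (le_max_left _ _).trans (le_ciSup (bddAbove_range_scalarCurvatureNeg (h.metric hs)) x)
  have hP : (h.canonicalSpincStructure hs hnd).perturbationNorm (h.taubesPerturbation hs hnd) ((h.canonicalSpincStructure hs hnd).indexAt x) x ≤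
      ⨆ y, (h.canonicalSpincStructure hs hnd).perturbationNorm (h.taubesPerturbation hs hnd) ((h.canonicalSpincStructure hs hnd).indexAt y) y :=
    le_ciSup ((h.canonicalSpincStructure hs hnd).bddAbove_range_perturbationNorm (h.taubesPerturbation hs hnd)) x
  have hE := h.abs_re_perturbation_pairing_beta_le hs hnd cfg ((h.canonicalSpincStructure hs hnd).indexAt x) x
  have hE' := neg_le_of_abs_le hE
  have hκb : 0 ≤ ((h.metric hs).scalarCurvature x + ⨆ y, max (-(h.metric hs).scalarCurvature y) 0) * h.betaSq hs hnd cfg x :=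
    mul_nonneg (by linarith) hb0
  have hPb : (h.canonicalSpincStructure hs hnd).perturbationNorm (h.taubesPerturbation hs hnd) ((h.canonicalSpincStructure hs hnd).indexAt x) x * h.betaSq hs hnd cfg x ≤
      (⨆ y, (h.canonicalSpincStructure hs hnd).perturbationNorm (h.taubesPerturbation hs hnd) ((h.canonicalSpincStructure hs hnd).indexAt y) y) * h.betaSq hs hnd cfg x :=
    mul_le_mul_of_nonneg_right hP hb0
  have hbdef : Complex.normSq (cfg.plusSpinor ((h.canonicalSpincStructure hs hnd).indexAt x) x 0) = h.betaSq hs hnd cfg x := rfl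
  rw [hbdef] at hE'
  rw [hC]
  nlinarith [hS, hκb, hPb, hE', hb0]

end AlmostComplexStructure.IsCompatibleWith


end Literature.Geometry.Symplectic

end
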